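import Mathlib
import Summits.Ventures.PercRepro2.Defs
import Summits.Ventures.PercRepro2.Independence
import Summits.Ventures.PercRepro2.Graph
import Summits.Ventures.PercRepro2.Exploration
import Summits.Ventures.PercRepro2.Induced
import Summits.Ventures.PercRepro2.R2PrimeThreeReduction
import Summits.Ventures.PercRepro2.YBridge
import Summits.Ventures.PercRepro2.HCov
import Summits.Ventures.PercRepro2.HCovFns
import Summits.Ventures.PercRepro2.HCovCubic
import Summits.Ventures.PercRepro2.HubModel
import Summits.Ventures.PercRepro2.HubLaw
import Summits.Ventures.PercRepro2.HubRootLaw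
import Summits.Ventures.PercRepro2.HubConn
import Summits.Ventures.PercRepro2.HubBernstein
import Summits.Ventures.PercRepro2.HubGc
import Summits.Ventures.PercRepro2.HubKron

/-!
# p1's kernel `K₃` on the hub states, and its hub table
(blind cell PercRepro2, typer-1 g8; NIGHT3-CERT.md §11 (ii), the typed R theorem, part T0/T2)

On the class R the twelve functions of `HCovFns.lean` (`iQ`, `iPD`, `σ_v`, `1_{v∈U}`, `f₃ … f₁₂`)
are functions of the state pair `(W ω, Π ω)` (`iL_eq`, …, `inU_eq`), so p1's eight-term kernel
`K₃ x y w` (`HCovCubic.K3`) is the ℤ-valued kernel `K3Z` of the three state pairs (`K3_eq`).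
Its **hub table** `WtotK3 k` (the signed sum of the eight integer hub tables of the eight terms)
has the Kronecker number `kronWK3` (`kronWK3_eq`), bounded by `18 · 2^21` (`abs_WtotK3_le`);
the kernel checks `HubKernelP1Chunk0.lean` … identify its symmetrisation with the same certificates
(`HubCertPart1–6`) as the weighted table (the two kernels give the same cubic form).
-/

namespace Summit.Ventures.PercRepro2.Hub

open CovForm

section Fns

/-- `1_{v ∈ C₁}` as a hub function. -/
def hL (v : Mark) : HubFn := ind (cE .a₁ v)

/-- `1_{v ∈ C₂}` as a hub function. -/
def hH (v : Mark) : HubFn := ind (cE .a₂ v)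

/-- `σ_v = 1_{v∈C₁} − 1_{v∈C₂}` as a hub function. -/
def hσ (v : Mark) : HubFn := hL v - hH v

/-- `1_{v∈U} = 1_{v∈C₁} + 1_{v∈C₂}` as a hub function. -/
def hU (v : Mark) : HubFn := hL v + hH v

/-- `1_Q` as a hub function. -/
def kQ : HubFn := ind hQ

/-- `1_PD` as a hub function. -/
def kPD : HubFn := ind hPD

/-- `f₃ = 1_PD 1_{o∈U}`. -/
def k3 : HubFn := kPD * hU .o

/-- `f₄ = 1_Q σ_o σ_b`. -/
def k4 : HubFn := kQ * (hσ .o * hσ .b)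

/-- `f₅ = 1_Q σ₃ σ_b`. -/
def k5 : HubFn := kQ * (hσ .a₃ * hσ .b)

/-- `f₆ = 1_Q σ₃ 1_{o∈U} σ_b`. -/
def k6 : HubFn := kQ * (hσ .a₃ * (hU .o * hσ .b))

/-- `f₇ = 1_Q σ_v`. -/
def k7 (v : Mark) : HubFn := kQ * hσ v

/-- `f₁₀ = 1_Q σ₃ 1_{o∈U}`. -/
def k10 : HubFn := kQ * (hσ .a₃ * hU .o)

/-- `f₁₁ = 1_PD 1_{o∈U} 1_{b∈U}`. -/
def k11 : HubFn := kPD * (hU .o * hU .b)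

/-- `f₁₂ = 1_PD 1_{b∈U}`. -/
def k12 : HubFn := kPD * hU .b

/-- **p1's kernel `K₃` on state pairs**: the eight terms of `HCovCubic.K3`. -/
def K3Z (w₁ : Fin 7 → Bool) (π₁ : Fin 3 → Bool) (w₂ : Fin 7 → Bool) (π₂ : Fin 3 → Bool)
    (w₃ : Fin 7 → Bool) (π₃ : Fin 3 → Bool) : ℤ :=
  kPD w₁ π₁ * (kQ w₂ π₂ * k4 w₃ π₃) + kQ w₁ π₁ * (k3 w₂ π₂ * k5 w₃ π₃) -
    kPD w₁ π₁ * (kQ w₂ π₂ * k6 w₃ π₃) - kPD w₁ π₁ * (k7 .b w₂ π₂ * k7 .o w₃ π₃) -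
    k3 w₁ π₁ * (k7 .b w₂ π₂ * k7 .a₃ w₃ π₃) + kPD w₁ π₁ * (k7 .b w₂ π₂ * k10 w₃ π₃) -
    kPD w₁ π₁ * (kQ w₂ π₂ * k11 w₃ π₃) + kQ w₁ π₁ * (k12 w₂ π₂ * k3 w₃ π₃)

end Fns

section Pointwise

variable {V : Type*} {E : Type*} {R : Type*} [Field R]
  {ends : E → Sym2 V} {o a₁ a₂ a₃ b : V}

/-- The indicator of a hub event at a configuration is the cast of its hub function. -/
lemma indicator_toEvent_eq (Ψ : HubEvt) (x : Config E) :
    (toEvent ends (markOf o a₁ a₂ a₃ b) Ψ).indicator (1 : Config E → R) x =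
      ((ind Ψ (rootState ends (markOf o a₁ a₂ a₃ b) x)
        (innerPat ends (markOf o a₁ a₂ a₃ b) x) : ℤ) : R) := by
  classical
  unfold ind
  rw [Set.indicator_apply]
  simp only [mem_toEvent]
  split_ifs <;> simp

variable (hinj : Function.Injective (markOf o a₁ a₂ a₃ b))
  (hR : ClassR ends (markOf o a₁ a₂ a₃ b))
include hinj hR

/-- `1_{v∈C₁}` at a configuration. -/
lemma iL_eq (v : Mark) (x : Config E) :
    iL ends a₁ (markOf o a₁ a₂ a₃ b v) x =
      ((hL v (rootState ends (markOf o a₁ a₂ a₃ b) x)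
        (innerPat ends (markOf o a₁ a₂ a₃ b) x) : ℤ) : R) := by
  unfold iL hL
  rw [← indicator_toEvent_eq]
  have h := connEvent_eq_toEvent hinj hR .a₁ v
  exact congrArg (fun S : Set (Config E) => S.indicator (1 : Config E → R) x) h

/-- `1_{v∈C₂}` at a configuration. -/
lemma iH_eq (v : Mark) (x : Config E) :
    iH ends a₂ (markOf o a₁ a₂ a₃ b v) x =
      ((hH v (rootState ends (markOf o a₁ a₂ a₃ b) x)
        (innerPat ends (markOf o a₁ a₂ a₃ b) x) : ℤ) : R) := by
  unfold iH hH
  rw [← indicator_toEvent_eq]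
  have h := connEvent_eq_toEvent hinj hR .a₂ v
  exact congrArg (fun S : Set (Config E) => S.indicator (1 : Config E → R) x) h

/-- `1_Q` at a configuration. -/
lemma iQ_eq (x : Config E) :
    iQ ends a₁ a₂ x =
      ((kQ (rootState ends (markOf o a₁ a₂ a₃ b) x)
        (innerPat ends (markOf o a₁ a₂ a₃ b) x) : ℤ) : R) := by
  unfold iQ kQ
  rw [← indicator_toEvent_eq]
  have h21 : connEvent ends a₂ a₁ = toEvent ends (markOf o a₁ a₂ a₃ b) (cE .a₂ .a₁) :=
    connEvent_eq_toEvent hinj hR .a₂ .a₁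
  have h : avoidAll ends a₂ {a₁} = toEvent ends (markOf o a₁ a₂ a₃ b) hQ := by
    rw [avoidAll_singleton_eq, h21, ← toEvent_not]
    rfl
  exact congrArg (fun S : Set (Config E) => S.indicator (1 : Config E → R) x) h

/-- `1_PD` at a configuration. -/
lemma iPD_eq (x : Config E) :
    iPD ends a₁ a₂ a₃ x =
      ((kPD (rootState ends (markOf o a₁ a₂ a₃ b) x)
        (innerPat ends (markOf o a₁ a₂ a₃ b) x) : ℤ) : R) := by
  unfold iPD kPD
  rw [← indicator_toEvent_eq]
  have h12 : connEvent ends a₁ a₂ = toEvent ends (markOf o a₁ a₂ a₃ b) (cE .a₁ .a₂) :=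
    connEvent_eq_toEvent hinj hR .a₁ .a₂
  have h31 : connEvent ends a₃ a₁ = toEvent ends (markOf o a₁ a₂ a₃ b) (cE .a₃ .a₁) :=
    connEvent_eq_toEvent hinj hR .a₃ .a₁
  have h32 : connEvent ends a₃ a₂ = toEvent ends (markOf o a₁ a₂ a₃ b) (cE .a₃ .a₂) :=
    connEvent_eq_toEvent hinj hR .a₃ .a₂
  have h : PDEvent ends a₁ a₂ a₃ = toEvent ends (markOf o a₁ a₂ a₃ b) hPD := by
    rw [PDEvent, Dtilde, UnionCluster.inU, h12, h31, h32, ← toEvent_or, ← toEvent_not,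
      ← toEvent_not, ← toEvent_and]
    rfl
  exact congrArg (fun S : Set (Config E) => S.indicator (1 : Config E → R) x) h

end Pointwise

section Kernel

variable {V : Type*} {E : Type*} [Fintype E] [DecidableEq E] [DecidableEq V] {R : Type*}
  [Field R] [LinearOrder R] [IsStrictOrderedRing R] {ends : E → Sym2 V} {o a₁ a₂ a₃ b : V}
  (hinj : Function.Injective (markOf o a₁ a₂ a₃ b)) (hR : ClassR ends (markOf o a₁ a₂ a₃ b))
include hinj hR

omit [Fintype E] [DecidableEq E] [DecidableEq V] [LinearOrder R] [IsStrictOrderedRing R] in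
/-- **p1's kernel is the kernel of the state pairs.** -/
theorem K3_eq (x y w : Config E) :
    K3 ends o a₁ a₂ a₃ b x y w =
      ((K3Z (rootState ends (markOf o a₁ a₂ a₃ b) x) (innerPat ends (markOf o a₁ a₂ a₃ b) x)
        (rootState ends (markOf o a₁ a₂ a₃ b) y) (innerPat ends (markOf o a₁ a₂ a₃ b) y)
        (rootState ends (markOf o a₁ a₂ a₃ b) w) (innerPat ends (markOf o a₁ a₂ a₃ b) w) : ℤ) : R) := by
  have eL : ∀ (v : Mark) (x : Config E), iL ends a₁ (markOf o a₁ a₂ a₃ b v) x =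
      ((hL v (rootState ends (markOf o a₁ a₂ a₃ b) x)
        (innerPat ends (markOf o a₁ a₂ a₃ b) x) : ℤ) : R) := iL_eq hinj hR
  have eH : ∀ (v : Mark) (x : Config E), iH ends a₂ (markOf o a₁ a₂ a₃ b v) x =
      ((hH v (rootState ends (markOf o a₁ a₂ a₃ b) x)
        (innerPat ends (markOf o a₁ a₂ a₃ b) x) : ℤ) : R) := iH_eq hinj hR
  have eQ := iQ_eq (R := R) hinj hR
  have ePD := iPD_eq (R := R) hinj hR
  have eLo := eL .o
  have eLa := eL .a₃
  have eLb := eL .b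
  have eHo := eH .o
  have eHa := eH .a₃
  have eHb := eH .b
  simp only [markOf] at eLo eLa eLb eHo eHa eHb
  unfold K3 sepKernel
  simp only [Fin.sum_univ_succ, Fin.sum_univ_zero, Matrix.cons_val_zero, Matrix.cons_val_succ,
    add_zero, f3, f4, f5, f6, f7, f10, f11, f12, sigma, CovForm.inU, eQ, ePD, eLo, eLa, eLb, eHo,
    eHa, eHb]
  unfold K3Z k3 k4 k5 k6 k7 k10 k11 k12 hσ hU
  simp only [Pi.mul_apply, Pi.add_apply, Pi.sub_apply]
  push_cast
  ring

end Kernel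

section Table

/-- **The hub table of p1's kernel** `K₃`: the signed sum of the eight integer hub tables. -/
def WtotK3 (k : Fin 7 → Fin 4) : Tensor3 :=
  wZ kPD kQ k4 k + wZ kQ k3 k5 k - wZ kPD kQ k6 k - wZ kPD (k7 .b) (k7 .o) k -
    wZ k3 (k7 .b) (k7 .a₃) k + wZ kPD (k7 .b) k10 k - wZ kPD kQ k11 k + wZ kQ k12 k3 k

/-- The hub table of `K₃` is the profile sum of `K3Z`. -/
lemma WtotK3_eq (k : Fin 7 → Fin 4) (π₁ π₂ π₃ : Fin 3 → Bool) :
    WtotK3 k π₁ π₂ π₃ =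
      ∑ t : (Fin 7 → Bool) × (Fin 7 → Bool) × (Fin 7 → Bool) with prof t.1 t.2.1 t.2.2 = k,
        K3Z t.1 π₁ t.2.1 π₂ t.2.2 π₃ := by
  unfold WtotK3 wZ K3Z
  simp only [Pi.add_apply, Pi.sub_apply, ← Finset.sum_add_distrib, ← Finset.sum_sub_distrib]
  refine Finset.sum_congr rfl fun t _ => ?_
  ring

/-- **The Kronecker hub number of `K₃`**. -/
def kronWK3 (π₁ π₂ π₃ : Fin 3 → Bool) : ℤ :=
  kronT kPD π₁ * kronT kQ π₂ * kronT k4 π₃ + kronT kQ π₁ * kronT k3 π₂ * kronT k5 π₃ -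
    kronT kPD π₁ * kronT kQ π₂ * kronT k6 π₃ - kronT kPD π₁ * kronT (k7 .b) π₂ * kronT (k7 .o) π₃ -
    kronT k3 π₁ * kronT (k7 .b) π₂ * kronT (k7 .a₃) π₃ +
    kronT kPD π₁ * kronT (k7 .b) π₂ * kronT k10 π₃ - kronT kPD π₁ * kronT kQ π₂ * kronT k11 π₃ +
    kronT kQ π₁ * kronT k12 π₂ * kronT k3 π₃

set_option maxRecDepth 8000 in
/-- **The Kronecker hub number of `K₃` carries its hub table.** -/
theorem kronWK3_eq (π₁ π₂ π₃ : Fin 3 → Bool) :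
    kronWK3 π₁ π₂ π₃ = ∑ k, WtotK3 k π₁ π₂ π₃ * KB ^ idx4K k := by
  unfold kronWK3 kronT
  simp only [kron_mul_mul, ← Finset.sum_add_distrib, ← Finset.sum_sub_distrib]
  refine Finset.sum_congr rfl fun k _ => ?_
  unfold WtotK3 wZ coef3
  simp only [Pi.add_apply, Pi.sub_apply]
  ring

/-- Bounds of the hub functions of `K₃` (crude). -/
lemma abs_k_le (w : Fin 7 → Bool) (π : Fin 3 → Bool) :
    |kQ w π| ≤ 1 ∧ |kPD w π| ≤ 1 ∧ |k3 w π| ≤ 2 ∧ |k4 w π| ≤ 1 ∧ |k5 w π| ≤ 1 ∧ |k6 w π| ≤ 2 ∧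
      |k7 .b w π| ≤ 1 ∧ |k7 .o w π| ≤ 1 ∧ |k7 .a₃ w π| ≤ 1 ∧ |k10 w π| ≤ 2 ∧ |k11 w π| ≤ 4 ∧
      |k12 w π| ≤ 2 := by
  have h := fun Ψ => ind_mem Ψ w π
  have hσb : ∀ v, |hσ v w π| ≤ 1 := by
    intro v
    unfold hσ hL hH
    simp only [Pi.sub_apply]
    rw [abs_le]
    constructor <;> linarith [h (cE .a₁ v), h (cE .a₂ v)]
  have hUb : ∀ v, |hU v w π| ≤ 2 := by
    intro v
    unfold hU hL hH
    simp only [Pi.add_apply]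
    rw [abs_le]
    constructor <;> linarith [h (cE .a₁ v), h (cE .a₂ v)]
  have hQb : |kQ w π| ≤ 1 := by
    unfold kQ
    rw [abs_le]
    constructor <;> linarith [h hQ]
  have hPDb : |kPD w π| ≤ 1 := by
    unfold kPD
    rw [abs_le]
    constructor <;> linarith [h hPD]
  have hm : ∀ {x y : ℤ} {a c : ℤ}, |x| ≤ a → |y| ≤ c → |x * y| ≤ a * c := fun hx hy =>
    (abs_mul _ _).le.trans (mul_le_mul hx hy (abs_nonneg _) ((abs_nonneg _).trans hx))
  refine ⟨hQb, hPDb, ?_, ?_, ?_, ?_, ?_, ?_, ?_, ?_, ?_, ?_⟩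
  · exact (hm hPDb (hUb .o)).trans (by norm_num)
  · exact (hm hQb (hm (hσb .o) (hσb .b))).trans (by norm_num)
  · exact (hm hQb (hm (hσb .a₃) (hσb .b))).trans (by norm_num)
  · exact (hm hQb (hm (hσb .a₃) (hm (hUb .o) (hσb .b)))).trans (by norm_num)
  · exact (hm hQb (hσb .b)).trans (by norm_num)
  · exact (hm hQb (hσb .o)).trans (by norm_num)
  · exact (hm hQb (hσb .a₃)).trans (by norm_num)
  · exact (hm hQb (hm (hσb .a₃) (hUb .o))).trans (by norm_num)
  · exact (hm hPDb (hm (hUb .o) (hUb .b))).trans (by norm_num)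
  · exact (hm hPDb (hUb .b)).trans (by norm_num)

/-- **The hub table of `K₃` is bounded**: `|W^{K₃}_k| ≤ 18 · 2^21`. -/
theorem abs_WtotK3_le (k : Fin 7 → Fin 4) (π₁ π₂ π₃ : Fin 3 → Bool) :
    |WtotK3 k π₁ π₂ π₃| ≤ 18 * 2097152 := by
  have hb := fun w π => abs_k_le w π
  have e1 := abs_wZ_le (fun w π => (hb w π).2.1) (fun w π => (hb w π).1)
    (fun w π => (hb w π).2.2.2.1) k π₁ π₂ π₃
  have e2 := abs_wZ_le (fun w π => (hb w π).1) (fun w π => (hb w π).2.2.1)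
    (fun w π => (hb w π).2.2.2.2.1) k π₁ π₂ π₃
  have e3 := abs_wZ_le (fun w π => (hb w π).2.1) (fun w π => (hb w π).1)
    (fun w π => (hb w π).2.2.2.2.2.1) k π₁ π₂ π₃
  have e4 := abs_wZ_le (fun w π => (hb w π).2.1) (fun w π => (hb w π).2.2.2.2.2.2.1)
    (fun w π => (hb w π).2.2.2.2.2.2.2.1) k π₁ π₂ π₃
  have e5 := abs_wZ_le (fun w π => (hb w π).2.2.1) (fun w π => (hb w π).2.2.2.2.2.2.1)
    (fun w π => (hb w π).2.2.2.2.2.2.2.2.1) k π₁ π₂ π₃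
  have e6 := abs_wZ_le (fun w π => (hb w π).2.1) (fun w π => (hb w π).2.2.2.2.2.2.1)
    (fun w π => (hb w π).2.2.2.2.2.2.2.2.2.1) k π₁ π₂ π₃
  have e7 := abs_wZ_le (fun w π => (hb w π).2.1) (fun w π => (hb w π).1)
    (fun w π => (hb w π).2.2.2.2.2.2.2.2.2.2.1) k π₁ π₂ π₃
  have e8 := abs_wZ_le (fun w π => (hb w π).1) (fun w π => (hb w π).2.2.2.2.2.2.2.2.2.2.2)
    (fun w π => (hb w π).2.2.1) k π₁ π₂ π₃
  unfold WtotK3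
  simp only [Pi.add_apply, Pi.sub_apply]
  rw [abs_le] at e1 e2 e3 e4 e5 e6 e7 e8 ⊢
  constructor <;> linarith

end Table

end Summit.Ventures.PercRepro2.Hub
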